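import Summits.AnomalousDissipation.AnomalousDissipation.Theses.ResponseTelescope
import Literature.Analysis.FluidPDE.TimePeriodicNSLatticeRealize

/-!
# Crux `EfficientAnchor` (stmt-AnomalousDissipation-2029, route ResponseTelescope, rank 3) — birth skeleton

`Lines/birth.lean` (planner-skel-stmt-AnomalousDissipation-2029-0, skeleton-register / BC3, 2026-08-17).

THE CRUX. One exact coherent state with turbulent drag at high Reynolds number: a smooth
divergence-free mean-zero force `f` on the FIRST STOKES SHELL of `T³` (`−Δf = 4π²f`), a viscosity
`ν > 0` and ONE time-periodic classical solution `(u, p)` of `NS_ν(f)` on `ℝ × T³` with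
`Ē = meanEnergy u > 0`, `β = Ī/Ē^{3/2} ≥ 1/10` and `r = (νĪ)^{1/2}/Ē ≤ 1/250`
(`Ī = meanDissipation ν u`; `Re_λ ≳ 320`). The route's own reading: "finite and in principle
certifiable (computer-assisted periodic orbit with interval enclosures of the two period means)".

THE LINE — A CERTIFIED ZERO ON THE SPACE–TIME FOURIER LATTICE (the architecture of every rigorous
periodic-orbit proof for Navier–Stokes to date: van den Berg–Breden–Lessard–van Veen 2021,
arXiv:1902.00384, Thm 1.1 — approximate orbit + Newton–Kantorovich ("radii polynomials") on a
Banach space of space–time Fourier coefficients; Zgliczyński 2004 / Arioli–Koch for other PDEs),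
typed over the tree's OWN lattice formulation of time-periodic Navier–Stokes on `T³`
(`Literature.Analysis.FluidPDE.TimePeriodicNSLattice*`, the discharge path of Henry's persistence
theorem `PeriodicNSOrbitPersists_holds`): a `τ`-periodic classical solution with mean-zero velocity
IS (both ways: `TimePeriodicLattice.orbit_equation` / `TimePeriodicLattice.realize_nonlinear`) a
conjugate-symmetric, transversal, rapidly decaying family `c : ℤ × ℤ³ → ℂ³` vanishing on the zero
spatial modes and solving, off `k = 0`,
  `(2πiωn + 4π²ν|k|²) c(n,k) + Π_k N[c,c](n,k) = [n = 0] f̂(k)`,   `ω = 1/τ`,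
and its two budgets are Parseval sums: `Ē = Σ‖c‖²`, `Ī = ν·4π² Σ|k|²‖c‖²`.

STUBS (3) and composition:
* `stub_latticeBudgets` (DICTIONARY, provable now, M–L): for `ω > 0` and a conjugate-symmetric
  rapidly decaying lattice family, the realised field `u(t,x) = Re F_c(ωt, x)` has
  `meanEnergy u = Σ‖c m‖²` and `meanDissipation ν u = ν · 4π² Σ |k|²‖c m‖²` (Fubini on
  `T⁴ = T¹ × T³`, Parseval, `𝓕(∂ᵢ·) = 2πikᵢ`, period means = `limsup` means for periodic
  functions — `Literature.Analysis.FluidPDE.meanEnergy_eq_of_periodic`, `meanDissipation_eq_of_periodic`).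
* `stub_uniformNewtonKantorovich` (A-POSTERIORI EXISTENCE, provable now, L): the Newton–Kantorovich
  theorem for the quadratic lattice map `G(c, ω)` with the period as an unknown, BORDERED by the
  phase condition `Re⟨∂ₛc̄, h⟩ = 0`, in the tree's norms `X = {Σ Λ²‖h‖² < ∞}`, `Λ = |n| + |k|²`,
  `Y = ℓ²`: if a finitely supported approximate solution `(c̄, ω̄)` has residual `≤ δ` in `Y`, the
  bordered linearisation is invertible with bound `K`, the projected convective symbol is bounded
  by `C_B` (`X × X → Y`), and `K²(4π + 2C_B)δ ≤ 1/2` (Kantorovich's `h = βLη ≤ 1/2`, the second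
  derivative of `G` being the CONSTANT `L ≤ 4π + 2C_B`), then an exact lattice solution `(c, ω)`
  exists within `2Kδ` of `(c̄, ω̄)`, in the class, and rapidly decaying (parabolic bootstrap of
  `TimePeriodicNSLatticeRegularity`). No `sorry`-free Newton–Kantorovich exists in Mathlib; the
  regularity half is in the tree.
* `stub_certifiedLatticeOrbit` (THE CERTIFICATE, open, XL — the crux's content): for SOME
  first-shell force and SOME `ν`, the finite data of such a certificate EXIST — a finitely
  supported `(c̄, ω̄)`, constants `δ, K, C_B` with the four inequalities — together with the ROBUST
  BUDGET WINDOW: every class family within `2Kδ` of `c̄` in `X` has lattice budgets obeying the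
  crux's three inequalities (`Ē > 0`, `Ē^{3/2}/10 ≤ νD`, `ν²D ≤ Ē²/250²`).
* `EfficientAnchor_of` (kernel-checked, no `sorry`): certificate ⇒ (Newton–Kantorovich) exact
  rapidly decaying lattice solution `(c, ω)`, `ω > 0`, budgets in the window ⇒
  (`TimePeriodicLattice.realize_nonlinear`, IN THE TREE) classical `ω⁻¹`-periodic solution of
  `NS_ν(f)` ⇒ (dictionary) its `meanEnergy` / `meanDissipation` are the lattice budgets ⇒ the crux.

Hardest stub: `stub_certifiedLatticeOrbit` — it carries the whole open content (is there a
turbulent-drag exact coherent state at `Re_λ ≳ 320`, and can ~`10⁷`–`10⁹` space–time modes be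
certified?); the other two are theorems. Why the transfer is not a costume: the certificate is a
FINITE object (finitely many interval inequalities plus two analytic constants), the form in which
periodic orbits of PDEs are actually proved to exist; the crux itself names no finite witness.

Disproof used: none exists (`ledger crux ls stmt-AnomalousDissipation-2029`: no workfiles, no
`Disproof.lean`, no `Negative/`, 2026-08-17). Negatives index (`ledger negatives --problem
AnomalousDissipation`): no refuted statement concerns a single periodic orbit at fixed `ν`; the 2-D
obstruction `Literature.Barriers.AnomalousDissipation.AlexakisDoering2006_energyDissipationBound`
(β ≲ Re^{-1/2}) is why any certificate must be genuinely three-dimensional — the lattice here is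
`ℤ × ℤ³` and nothing in the stubs forces `x₃`-independence.
-/

set_option linter.dupNamespace false

noncomputable section

open scoped BigOperators InnerProductSpace ComplexConjugate
open Filter Set Function MeasureTheory UnitAddTorus
open Literature.Analysis.FunctionSpaces Literature.Analysis.FunctionSpaces.Torus
open Literature.Analysis.FunctionSpaces.EuclideanSpace
open Literature.Analysis.FluidPDE Literature.Analysis.FluidPDE.ScalarFourier
open Summit.AnomalousDissipation.AnomalousDissipation.Theses.ResponseTelescope

namespace Summit.AnomalousDissipation.AnomalousDissipation.Cruxes.EfficientAnchor.Birth

/-! ## Vocabulary: the space–time Fourier lattice of time-periodic Navier–Stokes on `T³`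
(verbatim the objects of `Literature.Analysis.FluidPDE.TimePeriodicNSLattice*`, which keep them as
local notation; here they get names so that the stubs are legible) -/

/-- Lattice families `ℤ × ℤ³ → ℂ³` — space–time Fourier coefficients `c(n, k)` (time index `n`,
spatial frequency `k`) of a mean-zero velocity field on `T¹ × T³`. -/
abbrev Coef : Type := ℤ × (Fin 3 → ℤ) → EuclideanSpace ℂ (Fin 3)

/-- The parabolic weight `Λ(n, k) = |n| + |k|²` (maximal-regularity class `X = {Σ Λ²‖c‖² < ∞}`). -/
def wt (m : ℤ × (Fin 3 → ℤ)) : ℝ := |((m.1 : ℤ) : ℝ)| + freqNormSq m.2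

/-- The symbol `σ_{ν,ω}(n,k) = 2πiωn + 4π²ν|k|²` of `ω∂ₛ − νΔ` (drift `m₀ = 0`), written exactly
as in `TimePeriodicLattice.realize_nonlinear`. -/
def sym (ν ω : ℝ) (m : ℤ × (Fin 3 → ℤ)) : ℂ :=
  2 * Real.pi * Complex.I * (ω : ℂ) * (m.1 : ℂ) + ((4 * Real.pi ^ 2 * ν * freqNormSq m.2 : ℝ) : ℂ)

/-- The convective symbol `N[a,b](n,k) = Σ_{m'} Σ_j a_j(m') · 2πi(k − k')_j · b(m − m')` — the
coefficients of `(A·∇)B` — verbatim the local notation `𝐍[a, b]` of the lattice files. -/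
def conv (a b : Coef) (m : ℤ × (Fin 3 → ℤ)) : EuclideanSpace ℂ (Fin 3) :=
  WithLp.toLp 2 (fun p : Fin 3 => ∑ j : Fin 3, ∑' m' : ℤ × (Fin 3 → ℤ),
    a m' j * (dsym j (Prod.snd m - Prod.snd m') * b (m - m') p))

/-- The force family `y_f(n,k) = [n = 0] 𝓕(complexify ∘ f)(k)` of a steady force (used off `k = 0`). -/
def forceCoef (F : UnitAddTorus (Fin 3) → EuclideanSpace ℝ (Fin 3)) (m : ℤ × (Fin 3 → ℤ)) :
    EuclideanSpace ℂ (Fin 3) :=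
  if m.1 = 0 then mFourierCoeff (complexify ∘ F) m.2 else 0

/-- The extension `K ↦ c (K₀, tail K)` of a lattice family to `ℤ⁴` (local notation `𝐄` of the tree). -/
def extend (c : Coef) : (Fin 4 → ℤ) → EuclideanSpace ℂ (Fin 3) :=
  fun K : Fin 4 → ℤ => c ((K 0, Fin.tail K) : ℤ × (Fin 3 → ℤ))

/-- The velocity field REALISED by a lattice family at frequency `ω`:
`u(t, x) = Re F_{𝐄c}(ωt, x)` (`F` the Fourier synthesis on `T⁴`) — the field of
`TimePeriodicLattice.realize_nonlinear` with mean `m₀ = 0`. -/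
def realise (ω : ℝ) (c : Coef) : ℝ → UnitAddTorus (Fin 3) → EuclideanSpace ℝ (Fin 3) :=
  fun t x => realPart (fourierSynth (extend c) (Fin.cons (((ω * t : ℝ)) : UnitAddCircle) x))

/-- The LATTICE CLASS (the tree's state space `W`, `TimePeriodicLattice.exists_space`): zero
spatial modes vanish (mean-zero field), transversal (`k · c(n,k) = 0`: divergence free),
conjugate symmetric (`c(−m) = conj c(m)`: real field). -/
def InClass (c : Coef) : Prop :=
  (∀ n : ℤ, c (n, 0) = 0) ∧
    (∀ m : ℤ × (Fin 3 → ℤ), (∑ jj : Fin 3, ((m.2 jj : ℤ) : ℂ) * (c m) jj) = 0) ∧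
      ∀ m : ℤ × (Fin 3 → ℤ), c (-m) = conjVec (c m)

/-- `c` SOLVES THE TIME-PERIODIC NAVIER–STOKES LATTICE EQUATION with viscosity `ν`, frequency `ω`
and steady force `F`: off the zero spatial modes,
`σ_{ν,ω}(m) c(m) + Π_k N[c,c](m) = y_F(m)` — hypothesis `heq` of `realize_nonlinear` (with `m₀ = 0`). -/
def SolvesLattice (ν ω : ℝ) (F : UnitAddTorus (Fin 3) → EuclideanSpace ℝ (Fin 3)) (c : Coef) : Prop :=
  ∀ m : ℤ × (Fin 3 → ℤ), m.2 ≠ 0 →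
    sym ν ω m • c m + Torus.lerayCoeff m.2 (conv c c m) = forceCoef F m

/-- The RESIDUAL family `G_ν(c, ω) − y_F` of an approximate solution (zero on `k = 0`). -/
def residual (ν ω : ℝ) (F : UnitAddTorus (Fin 3) → EuclideanSpace ℝ (Fin 3)) (c : Coef) : Coef :=
  fun m => if m.2 = 0 then 0 else sym ν ω m • c m + Torus.lerayCoeff m.2 (conv c c m) - forceCoef F m

/-- The time derivative on the lattice: `(∂ₛc)(n,k) = 2πin · c(n,k)`. -/
def dsCoef (c : Coef) : Coef := fun m => (2 * Real.pi * Complex.I * (m.1 : ℂ)) • c m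

/-- The BORDERED LINEARISATION of `(c, ω) ↦ G_ν(c, ω)` at `(c̄, ω̄)` applied to `(h, μ)`:
`σ_{ν,ω̄} h + Π(N[c̄,h] + N[h,c̄]) + μ ∂ₛc̄` (the last term is `∂G/∂ω = ∂ₛc̄`). -/
def linOp (ν ω : ℝ) (cbar h : Coef) (μ : ℝ) : Coef := fun m =>
  sym ν ω m • h m + Torus.lerayCoeff m.2 (conv cbar h m + conv h cbar m) + (μ : ℂ) • dsCoef cbar m

/-- The PHASE functional `Re⟨∂ₛc̄, h⟩_{ℓ²}` fixing the time-translation symmetry. -/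
def phase (cbar h : Coef) : ℝ := ∑' m : ℤ × (Fin 3 → ℤ), (inner ℂ (dsCoef cbar m) (h m)).re

/-- `‖h‖_X² = Σ Λ(m)² ‖h m‖²` (maximal-regularity norm; `tsum`, used only with `XSummable`). -/
def xNormSq (h : Coef) : ℝ := ∑' m : ℤ × (Fin 3 → ℤ), wt m ^ 2 * ‖h m‖ ^ 2

/-- Square-summability in `X`. -/
def XSummable (h : Coef) : Prop := Summable fun m : ℤ × (Fin 3 → ℤ) => wt m ^ 2 * ‖h m‖ ^ 2

/-- `‖y‖_Y² = Σ ‖y m‖²` (`Y = ℓ²`; `tsum`, used only with `YSummable`). -/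
def yNormSq (y : Coef) : ℝ := ∑' m : ℤ × (Fin 3 → ℤ), ‖y m‖ ^ 2

/-- Square-summability in `Y`. -/
def YSummable (y : Coef) : Prop := Summable fun m : ℤ × (Fin 3 → ℤ) => ‖y m‖ ^ 2

/-- `C` BOUNDS THE PROJECTED CONVECTIVE SYMBOL `X × X → Y`: `‖Π N[a,b]‖_Y ≤ C ‖a‖_X ‖b‖_X` on the
class (true for the tree's explicit constant: `TimePeriodicLattice.tsum_enorm_nl_sq_le` /
`exists_bilinear`, `c = 18π(12 Σ_k |k|⁻⁴ + 1)`). -/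
def BilinearBound (C : ℝ) : Prop :=
  0 ≤ C ∧ ∀ a b : Coef, InClass a → InClass b → XSummable a → XSummable b →
    YSummable (fun m => Torus.lerayCoeff m.2 (conv a b m)) ∧
      yNormSq (fun m => Torus.lerayCoeff m.2 (conv a b m)) ≤ C ^ 2 * (xNormSq a * xNormSq b)

/-- The bordered linearisation at `(c̄, ω̄)` is INVERTIBLE WITH BOUND `K` from `Y` to the phase
hyperplane of `X × ℝ`: every class right-hand side `y ∈ Y` has a preimage `(h, μ)` with
`Re⟨∂ₛc̄, h⟩ = 0` and `‖h‖_X² + μ² ≤ K²‖y‖_Y²`, and the homogeneous problem has only the trivial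
solution (Henry's nondegeneracy (i)+(ii) made quantitative; it forces `∂ₛc̄ ≠ 0` and `K > 0`). -/
def BorderedInvertible (ν ω : ℝ) (cbar : Coef) (K : ℝ) : Prop :=
  (∀ y : Coef, InClass y → YSummable y →
      ∃ (h : Coef) (μ : ℝ), InClass h ∧ XSummable h ∧ phase cbar h = 0 ∧
        (∀ m : ℤ × (Fin 3 → ℤ), m.2 ≠ 0 → linOp ν ω cbar h μ m = y m) ∧
          xNormSq h + μ ^ 2 ≤ K ^ 2 * yNormSq y) ∧
    ∀ (h : Coef) (μ : ℝ), InClass h → XSummable h → phase cbar h = 0 →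
      (∀ m : ℤ × (Fin 3 → ℤ), m.2 ≠ 0 → linOp ν ω cbar h μ m = 0) → (∀ m, h m = 0) ∧ μ = 0

/-- LATTICE ENERGY `Σ ‖c m‖²` (= period mean of `‖u‖₂²` of the realised field, stub 1). -/
def latticeEnergy (c : Coef) : ℝ := ∑' m : ℤ × (Fin 3 → ℤ), ‖c m‖ ^ 2

/-- LATTICE ENSTROPHY `4π² Σ |k|² ‖c m‖²` (= period mean of `‖∇u‖₂²` of the realised field). -/
def latticeEnstrophy (c : Coef) : ℝ :=
  ∑' m : ℤ × (Fin 3 → ℤ), 4 * Real.pi ^ 2 * freqNormSq m.2 * ‖c m‖ ^ 2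

/-- The crux's BUDGET WINDOW read on the lattice: `Ē > 0`, `(1/10) Ē √Ē ≤ νD`,
`ν(νD) ≤ (1/250)² Ē²` with `Ē = latticeEnergy c`, `D = latticeEnstrophy c` (verbatim the three
inequalities of `EfficientAnchor` after the dictionary of stub 1). -/
def InWindow (ν : ℝ) (c : Coef) : Prop :=
  0 < latticeEnergy c ∧
    (1 / 10 : ℝ) * (latticeEnergy c * Real.sqrt (latticeEnergy c)) ≤ ν * latticeEnstrophy c ∧
      ν * (ν * latticeEnstrophy c) ≤ (1 / 250 : ℝ) ^ 2 * latticeEnergy c ^ 2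

/-! ## The three stub statements -/

/-- STUB 1 statement — THE BUDGET DICTIONARY. For `ω > 0` and a conjugate-symmetric lattice
family with rapidly decaying extension, the realised `ω⁻¹`-periodic field `u = realise ω c` has
`meanEnergy u = Σ‖c m‖²` and, for every `ν`, `meanDissipation ν u = ν · 4π² Σ|k|²‖c m‖²`. -/
def LatticeBudgets : Prop :=
  ∀ (ω : ℝ) (c : Coef), 0 < ω → (∀ m : ℤ × (Fin 3 → ℤ), c (-m) = conjVec (c m)) →
    RapidDecay (extend c) →
      meanEnergy (realise ω c) = latticeEnergy c ∧
        ∀ ν : ℝ, meanDissipation ν (realise ω c) = ν * latticeEnstrophy c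

/-- STUB 2 statement — UNIFORM NEWTON–KANTOROVICH ON THE LATTICE (with parabolic regularity).
For `ν > 0`, a smooth divergence-free mean-zero force `F`, a bilinear constant `C_B`, and a
finitely supported class family `c̄` with frequency `ω̄`: residual `≤ δ` in `Y`, bordered
linearisation invertible with bound `K`, `K²(4π + 2C_B)δ ≤ 1/2` and `2Kδ < ω̄` imply an exact
class solution `(c, ω)` of the lattice equation, rapidly decaying, within `2Kδ` of `(c̄, ω̄)` in
`X × ℝ`. -/
def UniformNewtonKantorovich : Prop :=
  ∀ ν : ℝ, 0 < ν → ∀ F : UnitAddTorus (Fin 3) → EuclideanSpace ℝ (Fin 3),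
    IsSmooth F → IsDivFree F → HasZeroMean F →
    ∀ C_B : ℝ, BilinearBound C_B →
    ∀ (ω₀ : ℝ) (cbar : Coef) (δ K : ℝ) (S : Finset (ℤ × (Fin 3 → ℤ))),
      InClass cbar → (∀ m, m ∉ S → cbar m = 0) → 0 ≤ δ → 0 ≤ K →
      YSummable (residual ν ω₀ F cbar) → yNormSq (residual ν ω₀ F cbar) ≤ δ ^ 2 →
      BorderedInvertible ν ω₀ cbar K →
      K ^ 2 * (4 * Real.pi + 2 * C_B) * δ ≤ 1 / 2 → 2 * K * δ < ω₀ →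
        ∃ (c : Coef) (ω : ℝ), InClass c ∧ RapidDecay (extend c) ∧ SolvesLattice ν ω F c ∧
          XSummable (fun m => c m - cbar m) ∧
            xNormSq (fun m => c m - cbar m) + (ω - ω₀) ^ 2 ≤ (2 * K * δ) ^ 2

/-- STUB 3 statement — THE CERTIFIED LATTICE ORBIT (the crux's content, transferred). There are a
first-shell force `F`, a viscosity `ν > 0` and certificate data `(C_B, ω̄, c̄, δ, K)` — `c̄`
finitely supported in the class — satisfying the hypotheses of stub 2, such that every rapidly
decaying class family within `2Kδ` of `c̄` in `X` has its lattice budgets in the crux's window. -/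
def CertifiedLatticeOrbit : Prop :=
  ∃ F : UnitAddTorus (Fin 3) → EuclideanSpace ℝ (Fin 3),
    IsSmooth F ∧ IsDivFree F ∧ HasZeroMean F ∧ (∀ x, laplacian F x = -((4 * Real.pi ^ 2) • F x)) ∧
    ∃ ν : ℝ, 0 < ν ∧
      ∃ (C_B ω₀ : ℝ) (cbar : Coef) (δ K : ℝ) (S : Finset (ℤ × (Fin 3 → ℤ))),
        BilinearBound C_B ∧ InClass cbar ∧ (∀ m, m ∉ S → cbar m = 0) ∧ 0 ≤ δ ∧ 0 ≤ K ∧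
        YSummable (residual ν ω₀ F cbar) ∧ yNormSq (residual ν ω₀ F cbar) ≤ δ ^ 2 ∧
        BorderedInvertible ν ω₀ cbar K ∧
        K ^ 2 * (4 * Real.pi + 2 * C_B) * δ ≤ 1 / 2 ∧ 2 * K * δ < ω₀ ∧
        ∀ c : Coef, InClass c → RapidDecay (extend c) → XSummable (fun m => c m - cbar m) →
          xNormSq (fun m => c m - cbar m) ≤ (2 * K * δ) ^ 2 → InWindow ν c

/-! ## The stubs -/

/-- **stub 1 — lattice budget dictionary** (provable now; size M–L).
`meanEnergy (realise ω c) = Σ‖c m‖²` and `meanDissipation ν (realise ω c) = ν·4π²Σ|k|²‖c m‖²`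
for `ω > 0`, `c` conjugate symmetric with `RapidDecay (extend c)`.
Why true: `realise ω c` is `ω⁻¹`-periodic and jointly smooth (`RapidDecay.isSmooth_fourierSynth`,
`isSmoothSpaceTimeOn_cons`), so its `limsup` means are period means
(`meanEnergy_eq_of_periodic`, `meanDissipation_eq_of_periodic`, already used by the proved
`CesaroMeanPeriodic`); the period mean of `∫‖u(t)‖²` is `∫_{T⁴}‖F_{𝐄c}‖²` by Fubini
(`Torus.integral_eq_integral_cons`) and the substitution `s = ωt`; conjugate symmetry makes the
synthesis real (`realPart` loses nothing) and Parseval on `T⁴` gives `Σ_K‖𝐄c(K)‖² = Σ_m‖c m‖²`;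
for the dissipation, smooth slices have `eGradNormSq.toReal = gradNormSq`
(`gradNormSq_eq_toReal_eGradNormSq_holds`) and `𝓕(∂_{i+1}U) = 2πik_i 𝓕U`
(`TimePeriodicLattice.mFourierCoeff_partialDeriv_succ_cons`). Leans on: TorusTimePeriodicLift,
TorusFourierSynthesis, TorusTrigPoly §Parseval, LongTimeAveragePeriodic. Why it might fail: only
through a normalisation slip (a factor `ω` or `4π²`) — then the window of stub 3 is re-scaled, the
line survives. Sources: Doering–Foias 2002 §2; Cheskidov 2023 §6 (period means); Grafakos 2014
Prop. 3.2.7 (Parseval). -/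
theorem stub_latticeBudgets :
    ∀ (ω : ℝ) (c : Coef), 0 < ω → (∀ m : ℤ × (Fin 3 → ℤ), c (-m) = conjVec (c m)) →
      RapidDecay (extend c) →
        meanEnergy (realise ω c) = latticeEnergy c ∧
          ∀ ν : ℝ, meanDissipation ν (realise ω c) = ν * latticeEnstrophy c := by
  sorry

/-- **stub 2 — uniform Newton–Kantorovich for the bordered time-periodic lattice map, with
parabolic regularity** (provable now; size L; the a-posteriori existence engine).
Why true: on `Z = X₀ × ℝ` (`X₀ = ker phase`, closed since `|phase h| ≤ 2π‖c̄‖_X‖h‖_X`) the map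
`Φ(h, μ) = G_ν(c̄ + h, ω̄ + μ) − y_F` is a polynomial of degree two (`G(c,ω) = ω∂ₛc + L₀c + ΠN[c,c]`),
so `D²Φ` is CONSTANT with `‖D²Φ‖ ≤ 4π + 2C_B` (`‖∂ₛh‖_Y ≤ 2π‖h‖_X` because `|n| ≤ Λ`, and
`BilinearBound`); `DΦ(0)` is the bordered linearisation, bijective `Z → Y` with `‖DΦ(0)⁻¹‖ ≤ K`
by `BorderedInvertible`; `‖Φ(0)‖_Y ≤ δ`. Kantorovich 1948 (Kantorovich–Akilov XVIII; Ortega–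
Rheinboldt 12.6.2): `h = βLη ≤ K²(4π+2C_B)δ ≤ 1/2` ⇒ a zero `z*` with
`‖z*‖ ≤ 2η/(1+√(1−2h)) ≤ 2Kδ`. The zero `c = c̄ + h*` is a class solution in `X` of the lattice
equation with `ω = ω̄ + μ* ≥ ω̄ − 2Kδ > 0`; rapid decay of `𝐄c` is the lattice bootstrap
`TimePeriodicLattice.moments_of_lattice_ineq` (TimePeriodicNSLatticeRegularity, smooth `F`), exactly
as in `PeriodicNSOrbitPersists_holds`. Leans on: TimePeriodicNSLatticeSpaces (§D–§F),
TimePeriodicNSLatticeRegularity, Mathlib `ContractingWith` (Newton as a contraction of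
`z ↦ z − DΦ(0)⁻¹Φ(z)` on the ball of radius `t*`). Why it might fail: it should not — the only
traps are bookkeeping ones (the `k = 0` modes, where everything vanishes by the class, and the
`tsum` conventions, guarded by the `XSummable`/`YSummable` clauses). Sources: Kantorovich 1948;
BergBredenLessardVeen2021 = arXiv:1902.00384 §3 (radii polynomials for NS orbits); Iooss 1972;
Henry 1981 Thm 8.3.2; Kielhöfer 2012 §I.8. -/
theorem stub_uniformNewtonKantorovich :
    ∀ ν : ℝ, 0 < ν → ∀ F : UnitAddTorus (Fin 3) → EuclideanSpace ℝ (Fin 3),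
      IsSmooth F → IsDivFree F → HasZeroMean F →
      ∀ C_B : ℝ, BilinearBound C_B →
      ∀ (ω₀ : ℝ) (cbar : Coef) (δ K : ℝ) (S : Finset (ℤ × (Fin 3 → ℤ))),
        InClass cbar → (∀ m, m ∉ S → cbar m = 0) → 0 ≤ δ → 0 ≤ K →
        YSummable (residual ν ω₀ F cbar) → yNormSq (residual ν ω₀ F cbar) ≤ δ ^ 2 →
        BorderedInvertible ν ω₀ cbar K →
        K ^ 2 * (4 * Real.pi + 2 * C_B) * δ ≤ 1 / 2 → 2 * K * δ < ω₀ →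
          ∃ (c : Coef) (ω : ℝ), InClass c ∧ RapidDecay (extend c) ∧ SolvesLattice ν ω F c ∧
            XSummable (fun m => c m - cbar m) ∧
              xNormSq (fun m => c m - cbar m) + (ω - ω₀) ^ 2 ≤ (2 * K * δ) ^ 2 := by
  sorry

/-- **stub 3 — the certified lattice orbit** (OPEN; size XL; the hardest stub = the crux's
content in certifiable form). For some first-shell force (Kolmogorov `sin(2πx₂)e₁`, ABC, the
cyclic `(sin 2πx₃, sin 2πx₁, sin 2πx₂)`, …) and some `ν`, a space–time Galerkin polynomial
`c̄` (finitely many modes `(n,k)`), a frequency `ω̄`, a residual bound `δ`, an inverse bound `K`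
for the bordered linearisation and a bilinear constant `C_B` with `K²(4π+2C_B)δ ≤ 1/2`,
`2Kδ < ω̄`, and a budget window robust in the `X`-ball of radius `2Kδ`: `Ē > 0`,
`Ē^{3/2}/10 ≤ νD`, `ν²D ≤ Ē²/62500` — i.e. `β ≥ 1/10` at `Re_λ ≳ 320`, a genuinely multiscale
orbit (`D/Ē ≥ 625²ν⁻²Ē·…`, Taylor wavenumber `≳ 25 k_f`). Why it might be true: first-shell 3-D
box turbulence (Kolmogorov flow: BorueOrszag1996, MusacchioBoffetta2014, `β ≈ 0.3–0.4`) is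
expected to be densely threaded by hyperbolic (hence nondegenerate, `K < ∞`) periodic orbits whose
budgets shadow the turbulent means (VanVeenKidaKawahara2006; YasudaGotoKawahara2014;
ChandlerKerswell2013 in 2-D); a hyperbolic orbit with budgets strictly inside the window makes the
statement true with `c̄` a high truncation of it. Why it might fail (the crux's recorded risk,
sharpened): no turbulent-drag UPO may exist at `Re_λ ≳ 320`, or all may be so unstable/long that
`K` (which grows like the orbit's Floquet conditioning) defeats any achievable `δ`; computed 3-D
UPOs stop at `R_λ ≈ 67` and certified NS orbits are 2-D at `ν = 0.265` (BergBredenLessardVeen2021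
Thm 1.1) — ~`10³`× fewer degrees of freedom than needed here; in 2-D the window is EMPTY
(`AlexakisDoering2006_energyDissipationBound`), so the certificate must be fully 3-D. Cheapest
falsifier: a DNS/Newton–GMRES hookstep search for short UPOs of 3-D Kolmogorov flow at
`Re_λ ≈ 60–100` already shows whether UPO drag coefficients reach `β ≥ 0.1` at moderate `r`
(the window's `r ≤ 1/250` can then only be approached by continuation in `ν`). Sources:
arXiv:1902.00384 (Thm 1.1, §3), arXiv:1804.00547 (pp. 2, 6–7), doi:10.1088/0169-5983/46/6/061413,
doi:10.1017/jfm.2013.122, BorueOrszag1996, MusacchioBoffetta2014. -/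
theorem stub_certifiedLatticeOrbit :
    ∃ F : UnitAddTorus (Fin 3) → EuclideanSpace ℝ (Fin 3),
      IsSmooth F ∧ IsDivFree F ∧ HasZeroMean F ∧ (∀ x, laplacian F x = -((4 * Real.pi ^ 2) • F x)) ∧
      ∃ ν : ℝ, 0 < ν ∧
        ∃ (C_B ω₀ : ℝ) (cbar : Coef) (δ K : ℝ) (S : Finset (ℤ × (Fin 3 → ℤ))),
          BilinearBound C_B ∧ InClass cbar ∧ (∀ m, m ∉ S → cbar m = 0) ∧ 0 ≤ δ ∧ 0 ≤ K ∧
          YSummable (residual ν ω₀ F cbar) ∧ yNormSq (residual ν ω₀ F cbar) ≤ δ ^ 2 ∧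
          BorderedInvertible ν ω₀ cbar K ∧
          K ^ 2 * (4 * Real.pi + 2 * C_B) * δ ≤ 1 / 2 ∧ 2 * K * δ < ω₀ ∧
          ∀ c : Coef, InClass c → RapidDecay (extend c) → XSummable (fun m => c m - cbar m) →
            xNormSq (fun m => c m - cbar m) ≤ (2 * K * δ) ^ 2 → InWindow ν c := by
  sorry

/-! ## Name-keyed aliases of the stub statements — the hypotheses of `EfficientAnchor_of`

The native skeleton audit (`#h21_check_skeleton`, run by `ledger skeleton check`) admits a
hypothesis of the composing theorem only if its head constant is a registered obligation or is
NAMED like a declared stub; `__Registered.stub_X` is statement `X` under the registered stub's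
short name (device of `Cruxes/MirrorFloorTG/Lines/birth.lean`, `Cruxes/CyclicWindLineLoud/Lines/birth.lean`).
Each alias is an `abbrev`, definitionally its statement. -/
namespace __Registered

/-- Alias of `LatticeBudgets` keyed by the registered stub name. -/
abbrev stub_latticeBudgets : Prop := LatticeBudgets
/-- Alias of `UniformNewtonKantorovich` keyed by the registered stub name. -/
abbrev stub_uniformNewtonKantorovich : Prop := UniformNewtonKantorovich
/-- Alias of `CertifiedLatticeOrbit` keyed by the registered stub name. -/
abbrev stub_certifiedLatticeOrbit : Prop := CertifiedLatticeOrbit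

end __Registered

/-! Registered-signature agreement: each stub theorem's (one-level unfolded) signature is, definitionally, the named
statement it witnesses (`Iff.rfl`; no `sorry` enters — only the stubs' TYPES are compared). -/
example : (∀ (ω : ℝ) (c : Coef), 0 < ω → (∀ m : ℤ × (Fin 3 → ℤ), c (-m) = conjVec (c m)) →
      RapidDecay (extend c) →
        meanEnergy (realise ω c) = latticeEnergy c ∧
          ∀ ν : ℝ, meanDissipation ν (realise ω c) = ν * latticeEnstrophy c) ↔
    __Registered.stub_latticeBudgets := Iff.rfl
example : UniformNewtonKantorovich ↔ __Registered.stub_uniformNewtonKantorovich := Iff.rfl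
example : CertifiedLatticeOrbit ↔ __Registered.stub_certifiedLatticeOrbit := Iff.rfl

/-! ## Proved: small lemmas and the composition -/

/-- `‖h‖_X² ≥ 0` (a `tsum` of nonnegative terms, junk value `0` included). -/
theorem xNormSq_nonneg (h : Coef) : 0 ≤ xNormSq h :=
  tsum_nonneg fun _ => mul_nonneg (sq_nonneg _) (sq_nonneg _)

/-- The drift symbol of `realize_nonlinear` vanishes for the mean `m₀ = 0`. -/
theorem drift_zero (m : ℤ × (Fin 3 → ℤ)) :
    2 * Real.pi * Complex.I *
        (∑ jj : Fin 3, ((((0 : EuclideanSpace ℝ (Fin 3)) jj : ℝ)) : ℂ) * ((m.2 jj : ℤ) : ℂ)) = 0 := by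
  simp

/-- **Composition** (kernel-checked, no `sorry` of its own): the three stub statements imply the
crux `Summit.AnomalousDissipation.AnomalousDissipation.Theses.ResponseTelescope.EfficientAnchor`
BY NAME. Certificate (stub 3) ⇒ Newton–Kantorovich (stub 2) gives an exact rapidly decaying class
solution `(c, ω)` of the lattice equation with `|ω − ω̄| ≤ 2Kδ < ω̄`, hence `ω > 0`, and with
`c` in the robust window; `TimePeriodicLattice.realize_nonlinear` (in the tree) turns `c` into a
classical `ω⁻¹`-periodic solution `u = realise ω c` of `NS_ν(F)`; the dictionary (stub 1)
identifies `meanEnergy u`, `meanDissipation ν u` with the lattice budgets, and the window is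
verbatim the crux's three inequalities. [folklore] -/
theorem EfficientAnchor_of :
    __Registered.stub_latticeBudgets → __Registered.stub_uniformNewtonKantorovich →
      __Registered.stub_certifiedLatticeOrbit → EfficientAnchor := by
  intro hB hNK hCert
  dsimp only [__Registered.stub_latticeBudgets, __Registered.stub_uniformNewtonKantorovich,
    __Registered.stub_certifiedLatticeOrbit, LatticeBudgets, UniformNewtonKantorovich,
    CertifiedLatticeOrbit] at hB hNK hCert
  obtain ⟨F, hFs, hFdiv, hF0, hFshell, ν, hν, C_B, ω₀, cbar, δ, K, S, hCB, hclass, hsupp, hδ, hK,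
    hresS, hres, hinv, hsmall, hω₀, hwin⟩ := hCert
  obtain ⟨c, ω, hc, hcr, hsol, hXs, hclose⟩ :=
    hNK ν hν F hFs hFdiv hF0 C_B hCB ω₀ cbar δ K S hclass hsupp hδ hK hresS hres hinv hsmall hω₀
  -- the exact frequency is positive: `|ω − ω₀| ≤ 2Kδ < ω₀`
  have hω : 0 < ω := by
    have h1 : (ω - ω₀) ^ 2 ≤ (2 * K * δ) ^ 2 :=
      le_trans (by linarith [xNormSq_nonneg (fun m => c m - cbar m)]) hclose
    have h2 : |ω - ω₀| ≤ |2 * K * δ| := sq_le_sq.mp h1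
    rw [abs_of_nonneg (by positivity : (0 : ℝ) ≤ 2 * K * δ)] at h2
    have h3 := (abs_le.mp h2).1
    linarith
  -- the budgets of `c` lie in the robust window
  have hXle : xNormSq (fun m => c m - cbar m) ≤ (2 * K * δ) ^ 2 :=
    le_trans (by linarith [sq_nonneg (ω - ω₀)]) hclose
  obtain ⟨hE0, hβ, hr⟩ := hwin c hc hcr hXs hXle
  -- realise the lattice solution as a classical `ω⁻¹`-periodic solution (tree theorem)
  obtain ⟨hc0, hct, hcs⟩ := hc
  have heq : ∀ m : ℤ × (Fin 3 → ℤ), m.2 ≠ 0 →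
      (2 * Real.pi * Complex.I * (ω : ℂ) * (m.1 : ℂ) + ((4 * Real.pi ^ 2 * ν * freqNormSq m.2 : ℝ) : ℂ) +
          2 * Real.pi * Complex.I *
            (∑ jj : Fin 3, ((((0 : EuclideanSpace ℝ (Fin 3)) jj : ℝ)) : ℂ) * ((m.2 jj : ℤ) : ℂ))) • c m +
        Torus.lerayCoeff m.2 (conv c c m) =
      if m.1 = 0 then mFourierCoeff (complexify ∘ F) m.2 else 0 := by
    intro m hm
    rw [drift_zero, add_zero]
    exact hsol m hm
  obtain ⟨p', hNS, hper⟩ :=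
    TimePeriodicLattice.realize_nonlinear (ν := ν) (m₀ := (0 : EuclideanSpace ℝ (Fin 3)))
      hω hFs hFdiv hF0 hc0 hct hcs hcr heq
  have e : (fun t : ℝ => fun x : UnitAddTorus (Fin 3) =>
      (0 : EuclideanSpace ℝ (Fin 3)) +
        realPart (fourierSynth (fun K : Fin 4 → ℤ => c ((K 0, Fin.tail K) : ℤ × (Fin 3 → ℤ)))
          (Fin.cons (((ω * t : ℝ)) : UnitAddCircle) x))) =
      realise ω c := by
    funext t x
    exact zero_add _
  rw [e] at hNS hper
  -- the dictionary
  obtain ⟨hEn, hDis⟩ := hB ω c hω hcs hcr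
  refine ⟨F, hFs, hFdiv, hF0, hFshell, ν, ω⁻¹, realise ω c, p', hν, inv_pos.2 hω, hper, hNS, ?_, ?_, ?_⟩
  · rw [hEn]; exact hE0
  · rw [hEn, hDis ν]; exact hβ
  · rw [hEn, hDis ν]; exact hr

/-- WIRING CHECK: the three sorried stubs compose to a closed term of the crux's type (modulo their
`sorry`s). Deliberately an `example` (no constant enters the environment), so that a BC3 probe
importing this file could not close `stub → EfficientAnchor` by `exact?` through a pre-composed
witness. -/
example : EfficientAnchor :=
  EfficientAnchor_of stub_latticeBudgets stub_uniformNewtonKantorovich stub_certifiedLatticeOrbit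

end Summit.AnomalousDissipation.AnomalousDissipation.Cruxes.EfficientAnchor.Birth

end
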